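import Summits.QuantumFields.YangMills.Theorems.UnitScaleTiltFluctuationComparisonRegPrGlobalSlackCanonicalPolymersCover
import Summits.QuantumFields.YangMills.Theorems.UnitScaleTiltFluctuationComparisonRegPrGlobalSlackCanonicalPolymersSizes
import HarnessLib

/-!
# `UnitScaleTiltFluctuationComparisonRegPrGlobalSlackCanonicalPolymersTermSize` — THE SIZE ROW `TermSizeTrivT` FOR THE CANONICAL POLYMERISATION OF A v3 FAMILY
# (crux `FluctuationComparisonRegPrL`, stmt-QuantumFields-19935, STUB 3⁗ `stub_globalTwoRunSlackFam`; width-lever lane A, the producer's fifth row)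

Seat ym-ust-19935-slack g0 (prover).  `T3AlphaInputsACTwoRunLevel.TermSizeTrivT D PT b₀ p₀ C κ₁` — «|PT K (K−n) i Y V| ≤ C·e^{−κ₁𝓛(Y)}·θ(n+1)²·L^{−4(K−n−i)}»,
print's (44) p.267 at the trivial history — for `D := dataOfV3 p (canonPolymer p)`, `PT := canonPT p`: the NEW term of a retained domain is `newTerm` of that domain
(`domSet_injective`) with tree length `dj` (`canonTreeLen_domSet`), bounded by `…Sizes.abs_newTerm_le_theta`; the OLD term of a block is `oldTerm` of that block
(`blockSet` injective) with tree length `0`, bounded by `…Sizes.abs_oldTerm_le` (`ℓ_i⁴ = L⁴·L^{−4(k+1−i)}`).  The one new geometric point: a block domain's canonical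
tree length VANISHES — if a `domSet` at step `i−1` coincides with a level-`i` block then (counting fine sites, `L ≤ M₁`) the domain is ONE cube, whose torus tree
length is `0` (`torusTreeLen_singleton`).

* §1 `card_mul_pow_le_sum_indicator_domSet` (`#X.1·L^{3(k+1)} ≤ #domSet X`), `dj_eq_zero_of_domSet_eq_blockSet`, `canonTreeLen_blockSet`;
* §2 `blockSet_injective`, `canonPT_new_eq`, `canonPT_old_eq` (the filters are singletons);
* §3 **`termSizeTrivT_canon`** — `TermSizeTrivT (dataOfV3 p (canonPolymer p)) (canonPT p) 𝔠.b₀ 𝔠.p₀ (max (newConst 𝔠) (oldConst 𝔠·L⁴)) κ₁` for `0 < κ₁ ≤ 𝔠.κ`,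
  `L ≤ M₁`, and the two coupling windows of `…Sizes` (quantified over the runs' steps).
Bookkeeping; nothing of [Balaban1985UV3] is asserted.

References: T. Bałaban, CMP 102 (1985) 255–275 [Balaban1985UV3] ((24)–(25) p.262, (43)–(46) pp.266–267, (59) p.270).
-/

set_option autoImplicit false

noncomputable section

namespace Summit.QuantumFields.YangMills.Theorems.GlobalSlackCanonicalPolymers

open scoped BigOperators
open Finset
open Literature.MathematicalPhysics.QuantumFieldTheory.Balaban1983to89
open Literature.MathematicalPhysics.QuantumFieldTheory.Balaban1983to89.T3ContinuumYM3Torus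
open Literature.MathematicalPhysics.QuantumFieldTheory.Balaban1983to89.T3UnitScaleTilt (θBal)
open Literature.MathematicalPhysics.QuantumFieldTheory.Balaban1983to89.T3LevelShift (fieldShift)
open Literature.MathematicalPhysics.QuantumFieldTheory.Balaban1983to89.T3AlphaInputsAC
open Literature.MathematicalPhysics.QuantumFieldTheory.Balaban1983to89.T3AlphaInputsACTwoRunLevel
open Literature.MathematicalPhysics.QuantumFieldTheory.Balaban1983to89.TreeLengthTorus (tsys TPt torusTreeLen_singleton)
open Literature.MathematicalPhysics.QuantumFieldTheory.Balaban1985CMP102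
open Literature.MathematicalPhysics.QuantumFieldTheory.Balaban1985CMP102.Setting
open Summit.QuantumFields.Balaban3D.Carriers
open Summit.QuantumFields.Balaban3D.Proofs.Primitives
open Summit.QuantumFields.YangMills.Theorems

variable {F : T3Family} {𝔠 : AlphaConsts F.L (suGroupModel 2).N} {γ : ℝ} {hγ : 0 < γ} {hγ1 : γ ≤ (min 𝔠.gamma0 1) ^ 2}

/-! ## §1 A block domain's canonical tree length vanishes -/

/-- **ALL cubes of a domain count**: `#X.1 · L^{3(k+1)} ≤ #domSet M₁ K k X` for `k + 1 ≤ m + K`, `L ≤ M₁` (disjoint big blocks, each of `pow_le_sum_indicator_domSet`'s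
size; in the small-torus case there is one cube). [cite: Balaban1985UV3, (24) p.262, (59) p.270] -/
theorem card_mul_pow_le_sum_indicator_domSet (hM : F.L ≤ 𝔠.M₁) (K k : ℕ) (hk : k + 1 ≤ F.m + K)
    (X : (tsys 3 (nblkOf (SK F 𝔠 γ hγ hγ1 K) 𝔠.lane.carrier k)).Dom) :
    (X.1.card : ℝ) * (F.L : ℝ) ^ (3 * (k + 1)) ≤ ∑ x : Site (F.P K) 0, (domSet (F := F) 𝔠.lane.carrier.M₁ K k X).indicator (fun _ => (1 : ℝ)) x := by
  classical
  have hM0 : 0 < 𝔠.M₁ := 𝔠.M₁_pos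
  by_cases hcase : 𝔠.M₁ ≤ (F.P K).sitesPerDir k
  · -- disjoint big blocks, one per cube of `X`
    have hN : nblkOf (SK F 𝔠 γ hγ hγ1 K) 𝔠.lane.carrier k = (F.P K).sitesPerDir k / 𝔠.M₁ := by
      rw [nblkOf_SK]; exact max_eq_right (Nat.div_pos hcase hM0)
    have ht : ∀ b : TPt 3 (nblkOf (SK F 𝔠 γ hγ hγ1 K) 𝔠.lane.carrier k), ∀ μ, (b μ).val * 𝔠.M₁ + 𝔠.M₁ ≤ (F.P K).sitesPerDir k := fun b μ => by
      have h1 : (b μ).val < (F.P K).sitesPerDir k / 𝔠.M₁ := lt_of_lt_of_eq (ZMod.val_lt (b μ)) hN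
      calc (b μ).val * 𝔠.M₁ + 𝔠.M₁ = ((b μ).val + 1) * 𝔠.M₁ := by ring
        _ ≤ ((F.P K).sitesPerDir k / 𝔠.M₁) * 𝔠.M₁ := Nat.mul_le_mul_right _ h1
        _ ≤ (F.P K).sitesPerDir k := Nat.div_mul_le_self _ _
    -- the level-`k` sites of all cubes of `X`
    let Zb : TPt 3 (nblkOf (SK F 𝔠 γ hγ hγ1 K) 𝔠.lane.carrier k) → Finset (Site (F.P K) k) :=
      fun b => univ.image (offSite F K k 𝔠.M₁ (fun μ => (b μ).val) (w := 𝔠.M₁))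
    have hZcard : ∀ b, (Zb b).card = 𝔠.M₁ ^ 3 := fun b => by
      show (univ.image _).card = _
      rw [card_image_of_injective _ (offSite_injective K k 𝔠.M₁ _ (ht b)), card_univ, Fintype.card_fun, Fintype.card_fin, Fintype.card_fin]
    have hlab : ∀ b, ∀ z ∈ Zb b, ∀ μ, (z μ).val / 𝔠.M₁ = (b μ).val := by
      intro b z hz μ
      obtain ⟨r, -, rfl⟩ := mem_image.mp hz
      exact bigLabel_offSite K k 𝔠.M₁ hM0 _ r μ (ht b μ)
    have hdisj : (X.1 : Set (TPt 3 _)).PairwiseDisjoint Zb := by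
      intro b _ b' _ hbb
      rw [Function.onFun, Finset.disjoint_left]
      intro z hz hz'
      exact hbb (funext fun μ => ZMod.val_injective _ ((hlab b z hz μ).symm.trans (hlab b' z hz' μ)))
    set Z := X.1.biUnion Zb with hZ
    have hZtot : Z.card = X.1.card * 𝔠.M₁ ^ 3 := by
      rw [hZ, card_biUnion hdisj, Finset.sum_const_nat fun b _ => hZcard b]
    have hsub : (univ.filter fun x : Site (F.P K) 0 => coarsen k x ∈ Z) ⊆
        univ.filter fun x => x ∈ domSet (F := F) 𝔠.lane.carrier.M₁ K k X := by
      intro x hx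
      rw [mem_filter] at hx ⊢
      obtain ⟨b, hb, hz⟩ := mem_biUnion.mp hx.2
      refine ⟨hx.1, ?_⟩
      simp only [domSet, Set.mem_setOf_eq]
      exact ⟨b, hb, funext fun μ => hlab b _ hz μ⟩
    rw [sum_indicator_eq_card]
    have hpow : X.1.card * F.L ^ (3 * (k + 1)) ≤ X.1.card * (𝔠.M₁ ^ 3 * ((F.P K).L ^ k) ^ 3) := by
      refine Nat.mul_le_mul_left _ ?_
      have e : F.L ^ (3 * (k + 1)) = F.L ^ 3 * (F.L ^ k) ^ 3 := by
        rw [show 3 * (k + 1) = 3 + k * 3 by ring, pow_add, pow_mul]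
      rw [e]
      exact Nat.mul_le_mul_right _ (Nat.pow_le_pow_left hM 3)
    calc (X.1.card : ℝ) * (F.L : ℝ) ^ (3 * (k + 1)) = ((X.1.card * F.L ^ (3 * (k + 1)) : ℕ) : ℝ) := by push_cast; ring
      _ ≤ ((X.1.card * (𝔠.M₁ ^ 3 * ((F.P K).L ^ k) ^ 3) : ℕ) : ℝ) := by exact_mod_cast hpow
      _ = ((univ.filter fun x : Site (F.P K) 0 => coarsen k x ∈ Z).card : ℝ) := by
          rw [card_filter_coarsen_mem K k (by omega) Z, hZtot]; push_cast; ring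
      _ ≤ _ := by exact_mod_cast card_le_card hsub
  · -- small torus: one cube only
    rw [not_le] at hcase
    have hN : nblkOf (SK F 𝔠 γ hγ hγ1 K) 𝔠.lane.carrier k = 1 := by rw [nblkOf_SK, Nat.div_eq_of_lt hcase]; rfl
    have hc1 : X.1.card ≤ 1 := by
      calc X.1.card ≤ (univ : Finset (TPt 3 (nblkOf (SK F 𝔠 γ hγ hγ1 K) 𝔠.lane.carrier k))).card := card_le_card (subset_univ _)
        _ = 1 := by rw [card_univ, TreeLengthTorus.card_tpt, hN]; norm_num
    have h1 := pow_le_sum_indicator_domSet (γ := γ) (hγ := hγ) (hγ1 := hγ1) hM K k hk X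
    have hc1' : (X.1.card : ℝ) ≤ 1 := by exact_mod_cast hc1
    have hx0 : (0 : ℝ) ≤ (F.L : ℝ) ^ (3 * (k + 1)) := by positivity
    nlinarith

/-- **A `domSet` THAT IS A BLOCK IS ONE CUBE**: `domSet M₁ K (i−1) X = blockSet K i y` (with `1 ≤ i ≤ m + K`, `L ≤ M₁`) forces `dj X = 0`. [cite: Balaban1985UV3, (24) p.262] -/
theorem dj_eq_zero_of_domSet_eq_blockSet (hM : F.L ≤ 𝔠.M₁) (K k : ℕ) (hk : k + 1 ≤ F.m + K)
    (X : (tsys 3 (nblkOf (SK F 𝔠 γ hγ hγ1 K) 𝔠.lane.carrier k)).Dom) (y : Site (F.P K) (k + 1))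
    (h : domSet (F := F) 𝔠.lane.carrier.M₁ K k X = blockSet K (k + 1) y) :
    (tsys 3 (nblkOf (SK F 𝔠 γ hγ hγ1 K) 𝔠.lane.carrier k)).dj X = 0 := by
  classical
  have hcnt := card_mul_pow_le_sum_indicator_domSet (γ := γ) (hγ := hγ) (hγ1 := hγ1) hM K k hk X
  rw [h, sum_indicator_blockSet K (k + 1) hk y] at hcnt
  have hL1 : (1 : ℝ) ≤ F.L := by exact_mod_cast F.hL.2.le
  have hpos : (0 : ℝ) < (F.L : ℝ) ^ (3 * (k + 1)) := by positivity
  have hc : (X.1.card : ℝ) ≤ 1 := by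
    by_contra hc
    rw [not_le] at hc
    nlinarith
  have hc' : X.1.card ≤ 1 := by exact_mod_cast hc
  obtain ⟨c, hc1⟩ := X.2.1
  have hX1 : X.1 = {c} := Finset.eq_singleton_iff_unique_mem.mpr ⟨hc1, fun b hb => Finset.card_le_one.mp hc' b hb c hc1⟩
  show TreeLengthTorus.torusTreeLen X.1 = 0
  rw [hX1]
  exact torusTreeLen_singleton c

/-- **THE CANONICAL TREE LENGTH OF A BLOCK DOMAIN IS `0`** (`1 ≤ i ≤ m + K`, `L ≤ M₁`). [cite: Balaban1985UV3, (24)-(25) p.262] -/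
theorem canonTreeLen_blockSet (p : ∀ K, AlphaInputsT3AC.PkgAtV3 F 𝔠 γ hγ hγ1 K) (hM : F.L ≤ 𝔠.M₁) (K i : ℕ) (hi1 : 1 ≤ i) (hi : i ≤ F.m + K)
    (y : Site (F.P K) i) : canonTreeLen p K i (blockSet K i y) = 0 := by
  obtain ⟨k, rfl⟩ : ∃ k, i = k + 1 := ⟨i - 1, by omega⟩
  unfold canonTreeLen
  have hsub : (fun X => (tsys 3 ((p K).𝔖 (k + 1 - 1)).Nblk).dj X) ''
      {X : (tsys 3 ((p K).𝔖 (k + 1 - 1)).Nblk).Dom | domSet (F := F) 𝔠.lane.carrier.M₁ K (k + 1 - 1) X = blockSet K (k + 1) y} ⊆ {0} := by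
    rintro t ⟨X, hX, rfl⟩
    rw [Set.mem_singleton_iff]
    exact dj_eq_zero_of_domSet_eq_blockSet (γ := γ) (hγ := hγ) (hγ1 := hγ1) hM K k hi X y hX
  rcases Set.subset_singleton_iff_eq.mp hsub with h | h
  · rw [h, Real.sInf_empty]
  · rw [h, csInf_singleton]

/-! ## §2 The filters defining `canonPT` are singletons -/

/-- Blocks are injective as point sets (every level-`i` site has a fine site over it, `i ≤ m + K`). [cite: Balaban1987RG1, (0.1) p.251] -/
theorem blockSet_injective (K i : ℕ) (hi : i ≤ F.m + K) : Function.Injective (blockSet (F := F) K i) := by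
  intro y y' h
  obtain ⟨x, hx⟩ := coarsen_surjective i (show i ≤ (F.P K).m + (F.P K).K from hi) y
  have : x ∈ blockSet K i y' := by rw [← h]; exact hx
  exact hx.symm.trans this

open Classical in
/-- At a retained domain the canonical new term IS `newTerm` of that domain. [cite: Balaban1985UV3, (43) p.266] -/
theorem canonPT_new_eq (p : ∀ K, AlphaInputsT3AC.PkgAtV3 F 𝔠 γ hγ hγ1 K) (K k : ℕ) (hk : k + 1 ≤ K)
    (X : (tsys 3 (nblkOf (SK F 𝔠 γ hγ hγ1 K) 𝔠.lane.carrier k)).Dom) (hX : X ∈ newDoms p K k (Hist.triv (F.P K) (k + 1)))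
    (W : GaugeField (F.P K) (k + 1) (Matrix.specialUnitaryGroup (Fin 2) ℂ)) :
    canonPT p K (k + 1) (k + 1) (domSet (F := F) 𝔠.lane.carrier.M₁ K k X) W = newTerm p K k X W := by
  have hkm : k ≤ F.m + K := by have := F.hm; omega
  have hfil : (newDoms p K k (Hist.triv (F.P K) (k + 1))).filter
      (fun X' => domSet (F := F) 𝔠.lane.carrier.M₁ K k X' = domSet (F := F) 𝔠.lane.carrier.M₁ K k X) = {X} := by
    ext X'
    simp only [mem_filter, mem_singleton]
    exact ⟨fun h => domSet_injective K k hkm h.2, fun h => by subst h; exact ⟨hX, rfl⟩⟩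
  simp only [canonPT, if_pos hk, ite_true]
  rw [hfil, sum_singleton]

open Classical in
/-- At a block the canonical old term IS `oldTerm` of that block. [cite: Balaban1985UV3, (43) p.266] -/
theorem canonPT_old_eq (p : ∀ K, AlphaInputsT3AC.PkgAtV3 F 𝔠 γ hγ hγ1 K) (K k : ℕ) (hk : k + 1 ≤ K) (i : ℕ) (hi : i ∈ Finset.Icc 1 k)
    (y : Site (F.P K) i)
    (hy : y ∈ oldBlocks 𝔠.lane.carrier.M₁ (rcolOf (SK F 𝔠 γ hγ hγ1 K) 𝔠.lane.carrier) (Hist.triv (F.P K) (k + 1)) i)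
    (W : GaugeField (F.P K) (k + 1) (Matrix.specialUnitaryGroup (Fin 2) ℂ)) :
    canonPT p K (k + 1) i (blockSet K i y) W = oldTerm p K k i y W := by
  have hik : i ≠ k + 1 := by have := (Finset.mem_Icc.mp hi).2; omega
  have him : i ≤ F.m + K := by have := (Finset.mem_Icc.mp hi).2; have := F.hm; omega
  have hfil : (oldBlocks 𝔠.lane.carrier.M₁ (rcolOf (SK F 𝔠 γ hγ hγ1 K) 𝔠.lane.carrier) (Hist.triv (F.P K) (k + 1)) i).filter
      (fun y' => blockSet K i y' = blockSet K i y) = {y} := by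
    ext y'
    simp only [mem_filter, mem_singleton]
    exact ⟨fun h => blockSet_injective K i him h.2, fun h => by subst h; exact ⟨hy, rfl⟩⟩
  simp only [canonPT, if_pos hk, if_neg hik]
  rw [hfil, sum_singleton]

/-! ## §3 The size row -/

/-- **`TermSizeTrivT` FOR THE CANONICAL POLYMERISATION OF EVERY v3 FAMILY**: for `0 < κ₁ ≤ 𝔠.κ`, `L ≤ M₁` and the two coupling windows of `…Sizes`
(`cB·r(g_k)g_kp(g_k) ≤ ρ/4` and `8L²B₃Z′·g_kp(g_k) ≤ ½` at every step `k < K` of every run), the canonical term function obeys print's (44) at the trivial history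
with constant `max (newConst 𝔠) (oldConst 𝔠·L⁴)`.  The producer's FIFTH row, discharged. [cite: Balaban1985UV3, (44)-(45) p.267, (34) p.264] -/
theorem termSizeTrivT_canon (p : ∀ K, AlphaInputsT3AC.PkgAtV3 F 𝔠 γ hγ hγ1 K) (hM : F.L ≤ 𝔠.M₁) {κ₁ : ℝ} (hκ₁ : 0 < κ₁) (hκle : κ₁ ≤ 𝔠.κ)
    (hw1 : ∀ K k, k + 1 ≤ K → 𝔠.cB * (B10.rFun 𝔠.r₀ ((SK F 𝔠 γ hγ hγ1 K).gk k) * (SK F 𝔠 γ hγ hγ1 K).gk k *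
        B10.pFun 𝔠.b₀ 𝔠.p₀ ((SK F 𝔠 γ hγ hγ1 K).gk k)) ≤ 𝔠.ρ / 4)
    (hw2 : ∀ K k, k + 1 ≤ K → 8 * (F.L : ℝ) ^ 2 * 𝔠.B₃ * 𝔠.Zfull *
        ((SK F 𝔠 γ hγ hγ1 K).gk k * B10.pFun 𝔠.b₀ 𝔠.p₀ ((SK F 𝔠 γ hγ hγ1 K).gk k)) ≤ 1 / 2) :
    TermSizeTrivT (AlphaInputsT3AC.dataOfV3 p (canonPolymer p)) (canonPT p) 𝔠.b₀ 𝔠.p₀ (max (newConst 𝔠) (oldConst 𝔠 * (F.L : ℝ) ^ 4)) κ₁ := by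
  classical
  refine ⟨hκ₁, fun K n hn V hV i hi1 hi2 Y hY => ?_⟩
  change Y ∈ canonLoc p K (K - n) (Hist.triv (F.P K) (K - n)) i at hY
  change |canonPT p K (K - n) i Y _| ≤ max (newConst 𝔠) (oldConst 𝔠 * (F.L : ℝ) ^ 4) *
    Real.exp (-κ₁ * canonTreeLen p K i Y) * θBal F.L γ 𝔠.b₀ 𝔠.p₀ (n + 1) ^ 2 * (((F.L : ℝ) ^ (K - n - i))⁻¹) ^ 4
  -- name the lattice level `K − n = k + 1`
  suffices hW : ∀ W : GaugeField (F.P K) (K - n) (Matrix.specialUnitaryGroup (Fin 2) ℂ), |canonPT p K (K - n) i Y W| ≤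
      max (newConst 𝔠) (oldConst 𝔠 * (F.L : ℝ) ^ 4) * Real.exp (-κ₁ * canonTreeLen p K i Y) *
        θBal F.L γ 𝔠.b₀ 𝔠.p₀ (n + 1) ^ 2 * (((F.L : ℝ) ^ (K - n - i))⁻¹) ^ 4 from hW _
  obtain ⟨k, hk⟩ : ∃ k, K - n = k + 1 := ⟨K - n - 1, by omega⟩
  rw [hk] at hY
  rw [hk]
  intro W
  have hkK : k + 1 ≤ K := by omega
  have hKk : K - k = n + 1 := by omega
  have hkm : k ≤ F.m + K := by have := F.hm; omega
  have hL1 : (1 : ℝ) ≤ F.L := by exact_mod_cast F.hL.2.le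
  have hL0 : (0 : ℝ) < F.L := by linarith
  have hθ2 : 0 ≤ θBal F.L γ 𝔠.b₀ 𝔠.p₀ (n + 1) ^ 2 := sq_nonneg _
  have hmax0 : 0 ≤ max (newConst 𝔠) (oldConst 𝔠 * (F.L : ℝ) ^ 4) := le_max_of_le_left (newConst_nonneg 𝔠)
  by_cases hik : i = k + 1
  · -- NEW term of a retained domain
    subst hik
    simp only [canonLoc, if_pos hkK, ite_true, mem_image] at hY
    obtain ⟨X, hX, rfl⟩ := hY
    rw [canonPT_new_eq p K k hkK X hX W, canonTreeLen_domSet p K k hkm X]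
    have hb := abs_newTerm_le_theta p K k hkK (hw1 K k hkK) X W
    rw [hKk] at hb
    refine hb.trans ?_
    have hx : (((F.L : ℝ) ^ (k + 1 - (k + 1)))⁻¹) ^ 4 = 1 := by simp
    rw [hx, mul_one]
    have hexp : Real.exp (-(𝔠.κ * (tsys 3 (nblkOf (SK F 𝔠 γ hγ hγ1 K) 𝔠.lane.carrier k)).dj X)) ≤
        Real.exp (-κ₁ * (tsys 3 (nblkOf (SK F 𝔠 γ hγ hγ1 K) 𝔠.lane.carrier k)).dj X) := by
      rw [Real.exp_le_exp]
      have := (tsys 3 (nblkOf (SK F 𝔠 γ hγ hγ1 K) 𝔠.lane.carrier k)).dj_nonneg X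
      nlinarith
    calc newConst 𝔠 * θBal F.L γ 𝔠.b₀ 𝔠.p₀ (n + 1) ^ 2 * Real.exp (-(𝔠.κ * (tsys 3 _).dj X))
        ≤ max (newConst 𝔠) (oldConst 𝔠 * (F.L : ℝ) ^ 4) * θBal F.L γ 𝔠.b₀ 𝔠.p₀ (n + 1) ^ 2 * Real.exp (-κ₁ * (tsys 3 _).dj X) :=
          mul_le_mul (mul_le_mul_of_nonneg_right (le_max_left _ _) hθ2) hexp (Real.exp_pos _).le (mul_nonneg hmax0 hθ2)
      _ = _ := by ring
  · by_cases hi : i ∈ Finset.Icc 1 k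
    · -- OLD term of a block
      simp only [canonLoc, if_pos hkK, if_neg hik, if_pos hi, mem_image] at hY
      obtain ⟨y, hy, rfl⟩ := hY
      have him : i ≤ F.m + K := by have := (Finset.mem_Icc.mp hi).2; omega
      rw [canonPT_old_eq p K k hkK i hi y hy W, canonTreeLen_blockSet p hM K i hi1 him y, mul_zero, Real.exp_zero, mul_one]
      have hb := abs_oldTerm_le p K k hkK i hi (hw2 K k hkK) y W
      have heps : (SK F 𝔠 γ hγ hγ1 K).gk k * B10.pFun 𝔠.b₀ 𝔠.p₀ ((SK F 𝔠 γ hγ hγ1 K).gk k) = θBal F.L γ 𝔠.b₀ 𝔠.p₀ (K - k) :=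
        (p K).eps1_eq k (by omega)
      rw [heps, hKk] at hb
      refine hb.trans ?_
      -- `ℓ_i⁴ = L⁴ · (L^{k+1−i})⁻⁴`
      have hik' : i ≤ k := (Finset.mem_Icc.mp hi).2
      have hell : ell (F.P K) k i ^ 4 = (F.L : ℝ) ^ 4 * (((F.L : ℝ) ^ (k + 1 - i))⁻¹) ^ 4 := by
        have e1 : ell (F.P K) k i = ((F.L : ℝ)⁻¹) ^ (k - i) := rfl
        have hL4 : ((F.L : ℝ) * (F.L : ℝ)⁻¹) ^ 4 = 1 := by rw [mul_inv_cancel₀ hL0.ne', one_pow]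
        rw [e1, show k + 1 - i = (k - i) + 1 by omega, pow_succ (F.L : ℝ) (k - i), mul_inv, mul_pow, ← inv_pow (F.L : ℝ) (k - i)]
        calc ((F.L : ℝ)⁻¹ ^ (k - i)) ^ 4 = ((F.L : ℝ)⁻¹ ^ (k - i)) ^ 4 * ((F.L : ℝ) * (F.L : ℝ)⁻¹) ^ 4 := by rw [hL4, mul_one]
          _ = _ := by ring
      rw [hell]
      calc oldConst 𝔠 * θBal F.L γ 𝔠.b₀ 𝔠.p₀ (n + 1) ^ 2 * ((F.L : ℝ) ^ 4 * (((F.L : ℝ) ^ (k + 1 - i))⁻¹) ^ 4)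
          = (oldConst 𝔠 * (F.L : ℝ) ^ 4) * θBal F.L γ 𝔠.b₀ 𝔠.p₀ (n + 1) ^ 2 * (((F.L : ℝ) ^ (k + 1 - i))⁻¹) ^ 4 := by ring
        _ ≤ _ := mul_le_mul_of_nonneg_right (mul_le_mul_of_nonneg_right (le_max_right _ _) hθ2) (by positivity)
    · simp only [canonLoc, if_pos hkK, if_neg hik, if_neg hi] at hY
      simp at hY

end Summit.QuantumFields.YangMills.Theorems.GlobalSlackCanonicalPolymers

end
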